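import Summits.QuantumFields.QCD.Theorems.EarlyCrosserLaw.Negative.LowerPinLoadBearing
import Summits.QuantumFields.QCD.Theorems.NestedDissectionSeaEarlyCrosserLawPinWindowCrossing

/-!
# The upper pin (b″) of crux `EarlyCrosserLaw` follows from the rarity of early TORUS crossers
(crux `Summit.QuantumFields.QCD.Theses.NestedDissectionSea.EarlyCrosserLaw`, item stmt-QuantumFields-13995;
line `cells-inherit-torus-extinction`, stub `upperPin_of_torusEarlyRarity`)

The upper parity pin (b″) `UpperPin Nf reg M₀ m R` bounds, for every `M > M₀`, eventually in `k`, on every odd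
torus `2S+1` of physical side `a_k(2S+1) ∈ [R, 2R]`, the phase-quenched probability of the SIGN event
`{U | Re det D_W(U, θ, 1) < 0}` at the probe mass `θ = m_crit(k) + a_k M / Z_m(k)` by `1/8`.

This file reduces (b″) to the rarity of EARLY TORUS CROSSERS, the event
`{U | ∃ μ' ≥ θ, det D_W(U, μ', 1) = 0}` ("the torus Wilson–Dirac operator is singular at some bare mass
`≥ θ`", i.e. the massless torus Wilson operator has a real eigenvalue `≤ -θ`):

* `torusEarly_of_re_neg` — pointwise, a negative sign at `θ` forces a torus crossing at some `μ' ∈ [θ, max θ 1]`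
  (Seiler positivity `fermionDet_wilsonDirac_re_pos` at the positive mass `max θ 1`, then the intermediate value
  theorem in the mass, `exists_fermionDet_eq_zero_of_re_neg_of_re_nonneg`);
* `torusEarly_isClosed` / `torusEarly_measurableSet` — the early-torus-crosser event is CLOSED (it is the first
  projection of the compact zero set `{(U, μ') | θ ≤ μ' ≤ max θ 1, det D_W(U, μ', 1) = 0}` of the jointly
  continuous `(U, μ') ↦ det D_W(U, μ', 1)`; no zeros at positive mass cap the mass range), hence Borel;
* `torusEarly_ratio_mono` — the phase-quenched ratio is monotone on measurable events (it is the probability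
  `qcdLatticeMeasure`, `pinnedLine_ratio_eq_measureReal`);
* `upperPin_of_torusEarlyRarity` — (b″) follows from `P(early torus crosser above θ) ≤ 1/8`.

Standard material [folklore]; no Theses statement is asserted.
-/

noncomputable section

open scoped BigOperators Classical
open Matrix Complex Filter MeasureTheory
open Literature.MathematicalPhysics.QuantumLattice Literature.MathematicalPhysics.QuantumFieldTheory
  Literature.Probability.LatticeModels
open Summit.QuantumFields.QCD.Theses.NestedDissectionSea
open Summit.QuantumFields.QCD.Theorems.EarlyCrosserLawNegative
open Summit.QuantumFields.QCD.Theorems.CoerciveSeaNegative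

namespace Summit.QuantumFields.QCD.Cruxes.EarlyCrosserLaw.PinnedLine

open Summit.QuantumFields.QCD.Cruxes.EarlyCrosserLaw.AccretiveCoarseJensen

/-! ## Pointwise: a negative sign forces an early torus crossing -/

/-- No torus crossing at positive bare mass: `det D_W(U, μ, 1) ≠ 0` for `μ > 0` (Seiler positivity,
`Re det > 0`). [folklore] -/
theorem torusEarly_fermionDet_ne_zero_of_pos {L : ℕ} [NeZero L] (U : GaugeConfig 4 L SU3) {μ : ℝ}
    (hμ : 0 < μ) : fermionDet (wilsonDirac (fundamentalRep (Fin 3)) U μ 1) ≠ 0 := by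
  intro h0
  have hpos := fermionDet_wilsonDirac_re_pos (fundamentalRep (Fin 3)) fundamentalRep_mem_unitaryGroup U hμ
  rw [h0, Complex.zero_re] at hpos
  exact lt_irrefl _ hpos

/-- **Sign ⇒ early torus crossing.** If `Re det D_W(U, θ, 1) < 0` then `det D_W(U, μ', 1) = 0` for some
`μ' ∈ [θ, max θ 1]` (`Re det > 0` at the positive mass `max θ 1`; intermediate value theorem in the mass).
[folklore] -/
theorem torusEarly_of_re_neg_Icc {L : ℕ} [NeZero L] (U : GaugeConfig 4 L SU3) {θ : ℝ}
    (h : (fermionDet (wilsonDirac (fundamentalRep (Fin 3)) U θ 1)).re < 0) :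
    ∃ μ' : ℝ, θ ≤ μ' ∧ μ' ≤ max θ 1 ∧ fermionDet (wilsonDirac (fundamentalRep (Fin 3)) U μ' 1) = 0 := by
  have h2 : 0 ≤ (fermionDet (wilsonDirac (fundamentalRep (Fin 3)) U (max θ 1) 1)).re :=
    (fermionDet_wilsonDirac_re_pos (fundamentalRep (Fin 3)) fundamentalRep_mem_unitaryGroup U
      (lt_of_lt_of_le one_pos (le_max_right θ 1))).le
  obtain ⟨t, ht, h0⟩ := exists_fermionDet_eq_zero_of_re_neg_of_re_nonneg U (le_max_left θ 1) h h2
  exact ⟨t, ht.1, ht.2, h0⟩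

/-- **Sign ⇒ early torus crossing** (unbounded form): if `Re det D_W(U, θ, 1) < 0` then the torus
Wilson–Dirac operator is singular at some bare mass `μ' ≥ θ`. [folklore] -/
theorem torusEarly_of_re_neg {L : ℕ} [NeZero L] (U : GaugeConfig 4 L SU3) {θ : ℝ}
    (h : (fermionDet (wilsonDirac (fundamentalRep (Fin 3)) U θ 1)).re < 0) :
    ∃ μ' : ℝ, θ ≤ μ' ∧ fermionDet (wilsonDirac (fundamentalRep (Fin 3)) U μ' 1) = 0 := by
  obtain ⟨μ', h1, -, h0⟩ := torusEarly_of_re_neg_Icc U h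
  exact ⟨μ', h1, h0⟩

/-- The early-torus-crosser event has a COMPACT mass range: a crossing at `μ' ≥ θ` has `μ' ≤ 0 ≤ max θ 1`
(no crossing at positive mass). [folklore] -/
theorem torusEarly_iff_Icc {L : ℕ} [NeZero L] (U : GaugeConfig 4 L SU3) (θ : ℝ) :
    (∃ μ' : ℝ, θ ≤ μ' ∧ fermionDet (wilsonDirac (fundamentalRep (Fin 3)) U μ' 1) = 0) ↔
      ∃ μ' : ℝ, θ ≤ μ' ∧ μ' ≤ max θ 1 ∧ fermionDet (wilsonDirac (fundamentalRep (Fin 3)) U μ' 1) = 0 := by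
  constructor
  · rintro ⟨μ', hθ, h0⟩
    have hle : μ' ≤ 0 := not_lt.mp fun hpos => torusEarly_fermionDet_ne_zero_of_pos U hpos h0
    exact ⟨μ', hθ, hle.trans (zero_le_one.trans (le_max_right θ 1)), h0⟩
  · rintro ⟨μ', hθ, -, h0⟩
    exact ⟨μ', hθ, h0⟩

/-! ## The early-torus-crosser event is closed, hence Borel -/

/-- `(U, μ') ↦ det D_W(U, μ', 1)` is JOINTLY continuous: the bare mass enters additively,
`D_W(U, μ', 1) = D_W(U, 0, 1) + μ'·1` (`wilsonDirac_mass_eq_add_smul`), and `U ↦ D_W(U, 0, 1)` is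
continuous (`continuous_wilsonDirac`). [folklore] -/
theorem torusEarly_continuous_fermionDet_joint {L : ℕ} [NeZero L] :
    Continuous fun z : GaugeConfig 4 L SU3 × ℝ =>
      fermionDet (wilsonDirac (fundamentalRep (Fin 3)) z.1 z.2 1) := by
  have h : (fun z : GaugeConfig 4 L SU3 × ℝ => wilsonDirac (fundamentalRep (Fin 3)) z.1 z.2 1) =
      fun z => wilsonDirac (fundamentalRep (Fin 3)) z.1 0 1 + ((z.2 : ℝ) : ℂ) • (1 : Matrix _ _ ℂ) := by
    funext z
    exact wilsonDirac_mass_eq_add_smul z.1 z.2 1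
  have hD : Continuous fun z : GaugeConfig 4 L SU3 × ℝ => wilsonDirac (fundamentalRep (Fin 3)) z.1 z.2 1 := by
    rw [h]
    exact ((continuous_wilsonDirac (fundamentalRep (Fin 3)) (continuous_fundamentalRep (Fin 3))
      0 1).comp continuous_fst).add ((Complex.continuous_ofReal.comp continuous_snd).smul continuous_const)
  exact hD.matrix_det

/-- The capped zero set `{(U, μ') | θ ≤ μ' ≤ max θ 1, det D_W(U, μ', 1) = 0}` is compact (closed, inside
the compact `univ ×ˢ [θ, max θ 1]`). [folklore] -/
theorem torusEarly_isCompact_zeroSet {L : ℕ} [NeZero L] (θ : ℝ) :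
    IsCompact {z : GaugeConfig 4 L SU3 × ℝ | θ ≤ z.2 ∧ z.2 ≤ max θ 1 ∧
      fermionDet (wilsonDirac (fundamentalRep (Fin 3)) z.1 z.2 1) = 0} := by
  refine (isCompact_univ.prod isCompact_Icc).of_isClosed_subset ?_
    fun z hz => ⟨Set.mem_univ _, hz.1, hz.2.1⟩
  simp only [Set.setOf_and]
  exact (isClosed_le continuous_const continuous_snd).inter ((isClosed_le continuous_snd continuous_const).inter
    (isClosed_eq torusEarly_continuous_fermionDet_joint continuous_const))

/-- The early-torus-crosser event is the first projection of the capped zero set. [folklore] -/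
theorem torusEarly_fst_image_zeroSet {L : ℕ} [NeZero L] (θ : ℝ) :
    Prod.fst '' {z : GaugeConfig 4 L SU3 × ℝ | θ ≤ z.2 ∧ z.2 ≤ max θ 1 ∧
      fermionDet (wilsonDirac (fundamentalRep (Fin 3)) z.1 z.2 1) = 0} =
      {U : GaugeConfig 4 L SU3 | ∃ μ' : ℝ, θ ≤ μ' ∧
        fermionDet (wilsonDirac (fundamentalRep (Fin 3)) U μ' 1) = 0} := by
  ext U
  rw [Set.mem_setOf_eq, torusEarly_iff_Icc U θ]
  constructor
  · rintro ⟨⟨U', μ'⟩, hz, rfl⟩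
    exact ⟨μ', hz⟩
  · rintro ⟨μ', hμ'⟩
    exact ⟨(U, μ'), hμ', rfl⟩

/-- **The early-torus-crosser event `{U | ∃ μ' ≥ θ, det D_W(U, μ', 1) = 0}` is CLOSED** in the configuration
space (continuous image of a compact set in a Hausdorff space). [folklore] -/
theorem torusEarly_isClosed {L : ℕ} [NeZero L] (θ : ℝ) :
    IsClosed {U : GaugeConfig 4 L SU3 | ∃ μ' : ℝ, θ ≤ μ' ∧
      fermionDet (wilsonDirac (fundamentalRep (Fin 3)) U μ' 1) = 0} := by
  rw [← torusEarly_fst_image_zeroSet]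
  exact ((torusEarly_isCompact_zeroSet θ).image continuous_fst).isClosed

/-- **The early-torus-crosser event is Borel measurable.** [folklore] -/
theorem torusEarly_measurableSet {L : ℕ} [NeZero L] (θ : ℝ) :
    MeasurableSet {U : GaugeConfig 4 L SU3 | ∃ μ' : ℝ, θ ≤ μ' ∧
      fermionDet (wilsonDirac (fundamentalRep (Fin 3)) U μ' 1) = 0} :=
  (torusEarly_isClosed θ).measurableSet

/-! ## Monotonicity of the phase-quenched ratio -/

/-- **`P(E) ≤ P(A)` for measurable events `E ⊆ A`** under the crux's phase-quenched ratio (which is the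
probability `qcdLatticeMeasure` of the event, `pinnedLine_ratio_eq_measureReal`). [folklore] -/
theorem torusEarly_ratio_mono {Nf : ℕ} (L : ℕ) [NeZero L] (β : ℝ) (mq : Fin Nf → ℝ)
    (E A : GaugeConfig 4 L SU3 → Prop) (hE : MeasurableSet {U | E U}) (hA : MeasurableSet {U | A U})
    (hEA : ∀ U, E U → A U) :
    (∫ U, (if E U then (1 : ℝ) else 0) * (∏ f, ‖fermionDet (wilsonDirac (fundamentalRep (Fin 3)) U (mq f) 1)‖)
        ∂(wilsonMeasure (fundamentalRep (Fin 3)) β : Measure (GaugeConfig 4 L SU3))) /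
      (∫ U, (∏ f, ‖fermionDet (wilsonDirac (fundamentalRep (Fin 3)) U (mq f) 1)‖)
        ∂(wilsonMeasure (fundamentalRep (Fin 3)) β : Measure (GaugeConfig 4 L SU3))) ≤
    (∫ U, (if A U then (1 : ℝ) else 0) * (∏ f, ‖fermionDet (wilsonDirac (fundamentalRep (Fin 3)) U (mq f) 1)‖)
        ∂(wilsonMeasure (fundamentalRep (Fin 3)) β : Measure (GaugeConfig 4 L SU3))) /
      (∫ U, (∏ f, ‖fermionDet (wilsonDirac (fundamentalRep (Fin 3)) U (mq f) 1)‖)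
        ∂(wilsonMeasure (fundamentalRep (Fin 3)) β : Measure (GaugeConfig 4 L SU3))) := by
  haveI := isProbabilityMeasure_qcdLatticeMeasure_all (S := L) β mq
  rw [pinnedLine_ratio_eq_measureReal L β mq E hE, pinnedLine_ratio_eq_measureReal L β mq A hA]
  exact measureReal_mono (fun U hU => hEA U hU) (measure_ne_top _ _)

/-! ## The upper pin from the rarity of early torus crossers -/

/-- **(b″) from early-torus-crosser rarity.** The upper pin (b″) `UpperPin Nf reg M₀ m R` follows from the
rarity of EARLY TORUS CROSSERS (the massless torus Wilson operator has a real eigenvalue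
`≤ -(m_crit + a_k M/Z_m)`, i.e. `D_W(U, μ', 1)` is singular at some `μ' ≥ m_crit + a_k M/Z_m`) on odd tori of
physical side in `[R, 2R]`: the sign event of (b″) is contained in the (closed, Borel) early-torus-crosser event
(`torusEarly_of_re_neg`) and the phase-quenched ratio is monotone (`torusEarly_ratio_mono`). [folklore] -/
theorem upperPin_of_torusEarlyRarity {Nf : ℕ} (reg : QCDRegularisation Nf) (M₀ : ℝ)
    (m : Fin Nf → ℝ) (R : ℝ)
    (h : ∀ M : ℝ, M₀ < M → ∀ᶠ k : ℕ in Filter.atTop, ∀ S : ℕ, R ≤ reg.a k * (2 * S + 1) →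
      reg.a k * (2 * S + 1) ≤ 2 * R →
      (∫ U, (if (∃ μ' : ℝ, reg.mcrit k + reg.a k * M / reg.Zm k ≤ μ' ∧
              fermionDet (wilsonDirac (fundamentalRep (Fin 3)) U μ' 1) = 0) then (1 : ℝ) else 0) *
          (∏ f, ‖fermionDet (wilsonDirac (fundamentalRep (Fin 3)) U
            (reg.mcrit k + reg.a k * m f / reg.Zm k) 1)‖)
        ∂(wilsonMeasure (fundamentalRep (Fin 3)) (reg.β k) : Measure (GaugeConfig 4 (2 * S + 1) SU3))) /
      (∫ U, (∏ f, ‖fermionDet (wilsonDirac (fundamentalRep (Fin 3)) U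
            (reg.mcrit k + reg.a k * m f / reg.Zm k) 1)‖)
        ∂(wilsonMeasure (fundamentalRep (Fin 3)) (reg.β k) : Measure (GaugeConfig 4 (2 * S + 1) SU3))) ≤
        (1 / 8 : ℝ)) :
    UpperPin Nf reg M₀ m R := by
  intro M hM
  filter_upwards [h M hM] with k hk
  intro S hS hS2
  dsimp only
  exact (torusEarly_ratio_mono (2 * S + 1) (reg.β k) (fun f => reg.mcrit k + reg.a k * m f / reg.Zm k)
    (fun U => (fermionDet (wilsonDirac (fundamentalRep (Fin 3)) U (reg.mcrit k + reg.a k * M / reg.Zm k) 1)).re < 0)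
    (fun U => ∃ μ' : ℝ, reg.mcrit k + reg.a k * M / reg.Zm k ≤ μ' ∧
      fermionDet (wilsonDirac (fundamentalRep (Fin 3)) U μ' 1) = 0)
    (pinnedLine_measurableSet_re_fermionDet_neg (2 * S + 1) _) (torusEarly_measurableSet _)
    (fun U hU => torusEarly_of_re_neg U hU)).trans (hk S hS hS2)

end Summit.QuantumFields.QCD.Cruxes.EarlyCrosserLaw.PinnedLine

end
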